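import Summits.NavierStokesRegularity.FluidComputer.PalasekTowerRegisterGlobalDesignExact
import Summits.NavierStokesRegularity.FluidComputer.PalasekTowerHostPreparation

/-!
# REGISTER v2.3′: the first child of the `EpisodeBaseG` split is INHABITED for the tree's one named host family

Cell `ns-blowup`, seat `ns-blowup-ecbridge-4` (g2); companion of `PalasekTowerRegisterGlobalDesignExact.lean`
(p424500: the singleton design class `HostClass.exact S₀`, `hostPreparationD_exact_iff`, the lossless split
`episodeBaseG_iff_exists_exact` — the 19179 split shape of record, planner AMENDMENT STATUS 2026-08-26 05:54Z)
and of seat `ns-blowup-ecbridge-3`'s `PalasekTowerHostPreparation.lean` (p428335: the prescribed-path host —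
`Host.hostSchedule L Lb …` with its globally anchored registered level-`0` stage `Host.stage_of_scales`, and
`Host.rungG_zero`). LABEL: E–C typing (KERNEL bookkeeping, proof only). WHAT THIS IS NOT: not Navier–Stokes
evidence — the host is a PRESCRIBED smooth flow whose force is its own residual and whose designed
continuation decays (its author's honest reading, STATUS l.2150); so the SECOND child
`FirstEpisodeD (HostClass.exact (Host.hostSchedule …))` is NOT claimed (and is not expected to hold for this
design); nothing here bears on `EpisodeBaseG` beyond `RungG 0`.

* `Host.hostPreparationD_exact` — for every admissible choice of the scales (`L, L_b ≥ 1` with the slab and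
  residual bounds of `Host.stage_of_scales`), `HostPreparationD (HostClass.exact (Host.hostSchedule L Lb …))`:
  the FIRST child of the 19179 split holds for the named design;
* `Host.exists_hostPreparationD_exact` — hence some singleton class carries the first child (the scales of
  `Host.exists_scales`), i.e. the method of record for that half (planner RULING l.2329 (1): «ecbridge-3's
  prescribed-path method is the intended prover of the HostPreparationD half for any explicit u*»).

References: S. Palasek, arXiv:2605.13827 §3.3–§4 [cite: Palasek2026ElementaryModel, §4].
-/

noncomputable section

namespace Summit.NavierStokesRegularity.FluidComputer.PalasekTowerClayBridge.Host

open Set MeasureTheory Filter Topology Function Real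
open scoped ENNReal ContDiff NNReal
open Literature.Analysis.FluidPDE

/-- **The first child of the split holds for the named host design**: for scales `L, L_b ≥ 1` under
the slab-speed and residual hypotheses of `stage_of_scales`, the singleton class of
`hostSchedule L Lb …` carries host preparation (pins, rigidity, quietness of the schedule and its
level-`0` stage, through `hostPreparationD_exact_iff`). [folklore] -/
theorem hostPreparationD_exact {L Lb : ℝ} (hL : 1 ≤ L) (hLb : 1 ≤ Lb)
    (hslab : ∀ x : EuclideanSpace ℝ (Fin 3), ‖slab L x‖ ≤ 11 / 10 * freq)
    (hpush : ∀ t ∈ Icc (1 : ℝ) τfirst, ∀ x : EuclideanSpace ℝ (Fin 3),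
      ‖resid L Lb t x‖ ≤ 1 / 200 * TowerRates.wide.Y 0) :
    HostPreparationD (HostClass.exact (hostSchedule L Lb hL hLb hpush)) :=
  (hostPreparationD_exact_iff _).2 ⟨hostSchedule_pins hL hLb hpush, hostSchedule_rigid hL hLb hpush,
    hostSchedule_quiet hL hLb hpush, stage_of_scales hL hLb hslab hpush⟩

/-- **Some singleton design class carries the first child of the split** (the scales of
`exists_scales`). [folklore] -/
theorem exists_hostPreparationD_exact :
    ∃ S₀ : Schedule TowerRates.wide, HostPreparationD (HostClass.exact S₀) := by
  obtain ⟨L, Lb, hL, hLb, hslab, hres⟩ := exists_scales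
  exact ⟨_, hostPreparationD_exact hL hLb hslab (fun t ht x => hres t ht.1 x)⟩

end Summit.NavierStokesRegularity.FluidComputer.PalasekTowerClayBridge.Host

end
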